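import Summits.KontsevichZagierPeriods.KontsevichZagierPeriods.Theorems.TerasomaMultiplicationBetaCancellationStubTameFormAux7
import Mathlib.Algebra.FreeAbelianGroup.Finsupp

/-!
# `BetaCancellation` (stmt-KontsevichZagierPeriods-13633), line `divisor-slicing-transshipment` — stub `stub_tameForm`, auxiliary file 14: extracting the normal form from a shadow

**From a vanishing shadow of `[X] − [Y]` to an isomorphism with a common spectator.** If
`Shadow ([X] − [Y])` holds with presentation `[X] − [Y] = ∑ᵢ [uᵢ] − ∑ⱼ [vⱼ]` and `X ≠ Y`, then
(coefficients in the free abelian group, `FreeAbelianGroup.toFinsupp`) for every representation `z`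
the number of `i` with `uᵢ = z` plus `[Y = z]` equals the number of `j` with `vⱼ = z` plus `[X = z]`;
so there are `i₀`, `j₀` with `u i₀ = X`, `v j₀ = Y` and a bijection `g` between the other indices with
`v (g i) = u i` (`Equiv.ofFiberEquiv`). Re-slotting the isomorphism `u⁺ ⊔ v⁻ ≅ v⁺ ⊔ u⁻` of the
shadow accordingly gives `X⁺ ⊔ Y⁻ ⊔ (t⁺ ⊔ t⁻) ≅ Y⁺ ⊔ X⁻ ⊔ (t⁺ ⊔ t⁻)` with the common spectator
`t = (uᵢ)_{i ≠ i₀}`.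

References: crux NOTES c6 (F13); the Grothendieck group of a commutative monoid.
-/

noncomputable section

-- `Summit.KontsevichZagierPeriods.KontsevichZagierPeriods.…` is the tree's mandated layout (single-conjunct summit).
set_option linter.dupNamespace false

namespace Summit.KontsevichZagierPeriods.KontsevichZagierPeriods.BetaCancellationDivisorSlicing

open MeasureTheory Set Function
open Literature.NumberTheory.Transcendental
open Literature.NumberTheory.Transcendental.KZ
open Literature.ModelTheory.ExponentialFields (IsSemialgebraic isSemialgebraic_univ)

/-! ### Coefficients -/

/-- **Comparing coefficients in the free abelian group.** [folklore] -/
theorem count_eq_of_eq {α : Type*} [DecidableEq α] {a b : ℕ} (u : Fin a → α) (v : Fin b → α) (X Y : α)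
    (h : FreeAbelianGroup.of X - FreeAbelianGroup.of Y =
      ∑ i, FreeAbelianGroup.of (u i) - ∑ j, FreeAbelianGroup.of (v j)) (z : α) :
    (∑ i, if u i = z then 1 else 0 : ℕ) + (if Y = z then 1 else 0) =
      (∑ j, if v j = z then 1 else 0 : ℕ) + (if X = z then 1 else 0) := by
  have h' := congrArg (fun c => FreeAbelianGroup.toFinsupp c z) h
  simp only [map_sub, map_sum, FreeAbelianGroup.toFinsupp_of, Finsupp.sub_apply,
    Finsupp.coe_finsetSum, Finset.sum_apply, Finsupp.single_apply] at h'
  have e1 : ((∑ i, if u i = z then 1 else 0 : ℕ) : ℤ) = ∑ i, if u i = z then (1 : ℤ) else 0 := by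
    push_cast; rfl
  have e2 : ((∑ j, if v j = z then 1 else 0 : ℕ) : ℤ) = ∑ j, if v j = z then (1 : ℤ) else 0 := by
    push_cast; rfl
  have e3 : ((if Y = z then 1 else 0 : ℕ) : ℤ) = if Y = z then (1 : ℤ) else 0 := by push_cast; rfl
  have e4 : ((if X = z then 1 else 0 : ℕ) : ℤ) = if X = z then (1 : ℤ) else 0 := by push_cast; rfl
  have : ((∑ i, if u i = z then 1 else 0 : ℕ) : ℤ) + ((if Y = z then 1 else 0 : ℕ) : ℤ) =
      ((∑ j, if v j = z then 1 else 0 : ℕ) : ℤ) + ((if X = z then 1 else 0 : ℕ) : ℤ) := by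
    rw [e1, e2, e3, e4]
    linarith
  exact_mod_cast this

/-- Cardinality of a fibre of a map out of `α ⊕ Unit`. [folklore] -/
theorem card_fibre_sum_unit {α γ : Type*} [Fintype α] [DecidableEq γ] (f : α → γ) (c z : γ) :
    Fintype.card {p : α ⊕ Unit // Sum.elim f (fun _ => c) p = z} =
      (∑ a, if f a = z then 1 else 0) + (if c = z then 1 else 0) := by
  rw [Fintype.card_subtype, Finset.card_filter, Fintype.sum_sum_type,
    Fintype.sum_unique (fun u : Unit => if Sum.elim f (fun _ => c) (Sum.inr u) = z then 1 else 0)]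
  simp only [Sum.elim_inl, Sum.elim_inr]
  congr! 3

namespace Shadow

/-- **Extraction of the normal form with a common spectator** from a vanishing shadow of
`[X] − [Y]`, `X ≠ Y`. [folklore] -/
theorem extract {n m : ℕ} (X : IntegralRep n) (Y : IntegralRep m) (S : Shadow (of X - of Y))
    (hXY : (⟨n, X⟩ : Σ k, IntegralRep k) ≠ ⟨m, Y⟩) :
    ∃ (s : ℕ) (t : Fin s → Σ k, IntegralRep k) (N : ℕ) (hX : n ≤ N) (hY : m ≤ N)
      (_ : ∀ i, (t i).1 ≤ N),
      Nonempty (MIso N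
        (Sum.elim (fun _ : Unit => stabSet hX (posSet X)) (Sum.elim (fun _ : Unit => stabSet hY (negSet Y))
          (Sum.elim (fun i => liftSet N (posSet (t i).2)) (fun i => liftSet N (negSet (t i).2)))))
        (Sum.elim (fun _ => stabFun hX X.integrand) (Sum.elim (fun _ => stabFun hY (-Y.integrand))
          (Sum.elim (fun i => liftFun N (t i).2.integrand) (fun i => liftFun N (-(t i).2.integrand)))))
        (Sum.elim (fun _ : Unit => stabSet hY (posSet Y)) (Sum.elim (fun _ : Unit => stabSet hX (negSet X))
          (Sum.elim (fun i => liftSet N (posSet (t i).2)) (fun i => liftSet N (negSet (t i).2)))))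
        (Sum.elim (fun _ => stabFun hY Y.integrand) (Sum.elim (fun _ => stabFun hX (-X.integrand))
          (Sum.elim (fun i => liftFun N (t i).2.integrand) (fun i => liftFun N (-(t i).2.integrand)))))) := by
  classical
  obtain ⟨a, b, u, v, eq, N, hu, hv, iso⟩ := S
  -- coefficients
  have hcount := count_eq_of_eq u v (⟨n, X⟩ : Σ k, IntegralRep k) ⟨m, Y⟩ eq
  -- the label maps and the label-preserving bijection
  let L : Fin a ⊕ Unit → Σ k, IntegralRep k := Sum.elim u fun _ => ⟨m, Y⟩
  let R : Fin b ⊕ Unit → Σ k, IntegralRep k := Sum.elim v fun _ => ⟨n, X⟩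
  have hcard : ∀ z, Fintype.card {p // L p = z} = Fintype.card {q // R q = z} := fun z => by
    rw [card_fibre_sum_unit, card_fibre_sum_unit, hcount z]
  let e : Fin a ⊕ Unit ≃ Fin b ⊕ Unit :=
    Equiv.ofFiberEquiv (f := L) (g := R) fun z => Fintype.equivOfCardEq (hcard z)
  have he : ∀ p, R (e p) = L p := fun p => Equiv.ofFiberEquiv_map _ p
  have he' : ∀ q, L (e.symm q) = R q := fun q => by
    have := he (e.symm q)
    rw [Equiv.apply_symm_apply] at this
    exact this.symm
  -- locate `X` in `u` and `Y` in `v`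
  obtain ⟨j₀, hj₀⟩ : ∃ j₀, e (Sum.inr ()) = Sum.inl j₀ := by
    rcases h : e (Sum.inr ()) with j₀ | u₀
    · exact ⟨j₀, rfl⟩
    · have := he (Sum.inr ())
      rw [h] at this
      exact absurd this hXY
  obtain ⟨i₀, hi₀⟩ : ∃ i₀, e.symm (Sum.inr ()) = Sum.inl i₀ := by
    rcases h : e.symm (Sum.inr ()) with i₀ | u₀
    · exact ⟨i₀, rfl⟩
    · have := he' (Sum.inr ())
      rw [h] at this
      exact absurd this.symm hXY
  have hvj₀ : v j₀ = ⟨m, Y⟩ := by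
    have := he (Sum.inr ())
    rwa [hj₀] at this
  have hui₀ : u i₀ = ⟨n, X⟩ := by
    have := he' (Sum.inr ())
    rwa [hi₀] at this
  -- the bijection between the remaining indices
  have hg : ∀ i : {i : Fin a // i ≠ i₀}, ∃ j : {j : Fin b // j ≠ j₀}, e (Sum.inl i.1) = Sum.inl j.1 := by
    rintro ⟨i, hi⟩
    rcases h : e (Sum.inl i) with j | w
    · refine ⟨⟨j, fun hj => ?_⟩, rfl⟩
      subst hj
      have : (Sum.inl i : Fin a ⊕ Unit) = Sum.inr () := e.injective (h.trans hj₀.symm)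
      exact Sum.inl_ne_inr this
    · have : (Sum.inl i : Fin a ⊕ Unit) = Sum.inl i₀ := by
        rw [← hi₀, ← h, Equiv.symm_apply_apply]
      exact absurd (Sum.inl_injective this) hi
  choose g hg using hg
  have hg' : ∀ j : {j : Fin b // j ≠ j₀}, ∃ i : {i : Fin a // i ≠ i₀}, g i = j := by
    rintro ⟨j, hj⟩
    rcases h : e.symm (Sum.inl j) with i | w
    · have hi : i ≠ i₀ := by
        rintro rfl
        have : (Sum.inl j : Fin b ⊕ Unit) = Sum.inr () := by
          rw [← Equiv.apply_symm_apply e (Sum.inl j), h, ← hi₀, Equiv.apply_symm_apply]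
        exact Sum.inl_ne_inr this
      refine ⟨⟨i, hi⟩, Subtype.ext ?_⟩
      have h1 := hg ⟨i, hi⟩
      rw [← h, Equiv.apply_symm_apply] at h1
      exact (Sum.inl_injective h1).symm
    · have : (Sum.inl j : Fin b ⊕ Unit) = Sum.inl j₀ := by
        rw [← hj₀, ← h, Equiv.apply_symm_apply]
      exact absurd (Sum.inl_injective this) hj
  have hginj : Function.Injective g := fun i i' h => by
    have h1 := hg i
    have h2 := hg i'
    rw [h, ← h2] at h1
    exact Subtype.ext (Sum.inl_injective (e.injective h1))
  have hgu : ∀ i : {i : Fin a // i ≠ i₀}, v (g i).1 = u i.1 := fun i => by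
    have := he (Sum.inl i.1)
    rwa [hg i] at this
  -- the spectator
  let s := Fintype.card {i : Fin a // i ≠ i₀}
  let en : Fin s ≃ {i : Fin a // i ≠ i₀} := (Fintype.equivFin {i : Fin a // i ≠ i₀}).symm
  let t : Fin s → Σ k, IntegralRep k := fun k => u (en k).1
  have hX : n ≤ N := by simpa [hui₀] using hu i₀
  have hY : m ≤ N := by simpa [hvj₀] using hv j₀
  have ht : ∀ k, (t k).1 ≤ N := fun k => hu _
  -- the re-slotting maps
  let fsrc : Unit ⊕ (Unit ⊕ (Fin s ⊕ Fin s)) → Fin a ⊕ Fin b :=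
    Sum.elim (fun _ => Sum.inl i₀) (Sum.elim (fun _ => Sum.inr j₀)
      (Sum.elim (fun k => Sum.inl (en k).1) (fun k => Sum.inr (g (en k)).1)))
  let ftgt : Unit ⊕ (Unit ⊕ (Fin s ⊕ Fin s)) → Fin b ⊕ Fin a :=
    Sum.elim (fun _ => Sum.inl j₀) (Sum.elim (fun _ => Sum.inr i₀)
      (Sum.elim (fun k => Sum.inl (g (en k)).1) (fun k => Sum.inr (en k).1)))
  have hfsrc : Function.Bijective fsrc := by
    constructor
    · rintro (_ | _ | k | k) (_ | _ | k' | k') h <;> simp only [fsrc, Sum.elim_inl, Sum.elim_inr,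
        Sum.inl.injEq, Sum.inr.injEq, reduceCtorEq] at h ⊢
      · exact absurd h.symm (en k').2
      · exact absurd h.symm (g (en k')).2
      · exact absurd h (en k).2
      · exact en.injective (Subtype.ext h)
      · exact absurd h (g (en k)).2
      · exact en.injective (hginj (Subtype.ext h))
    · rintro (i | j)
      · by_cases hi : i = i₀
        · exact ⟨Sum.inl (), by simp [fsrc, hi]⟩
        · exact ⟨Sum.inr (Sum.inr (Sum.inl (en.symm ⟨i, hi⟩))), by simp [fsrc]⟩
      · by_cases hj : j = j₀
        · exact ⟨Sum.inr (Sum.inl ()), by simp [fsrc, hj]⟩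
        · obtain ⟨i, hi⟩ := hg' ⟨j, hj⟩
          exact ⟨Sum.inr (Sum.inr (Sum.inr (en.symm i))), by simp [fsrc, hi]⟩
  have hftgt : Function.Bijective ftgt := by
    constructor
    · rintro (_ | _ | k | k) (_ | _ | k' | k') h <;> simp only [ftgt, Sum.elim_inl, Sum.elim_inr,
        Sum.inl.injEq, Sum.inr.injEq, reduceCtorEq] at h ⊢
      · exact absurd h.symm (g (en k')).2
      · exact absurd h.symm (en k').2
      · exact absurd h (g (en k)).2
      · exact en.injective (hginj (Subtype.ext h))
      · exact absurd h (en k).2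
      · exact en.injective (Subtype.ext h)
    · rintro (j | i)
      · by_cases hj : j = j₀
        · exact ⟨Sum.inl (), by simp [ftgt, hj]⟩
        · obtain ⟨i, hi⟩ := hg' ⟨j, hj⟩
          exact ⟨Sum.inr (Sum.inr (Sum.inl (en.symm i))), by simp [ftgt, hi]⟩
      · by_cases hi : i = i₀
        · exact ⟨Sum.inr (Sum.inl ()), by simp [ftgt, hi]⟩
        · exact ⟨Sum.inr (Sum.inr (Sum.inr (en.symm ⟨i, hi⟩))), by simp [ftgt]⟩
  obtain ⟨m'⟩ := iso.reindex (Equiv.ofBijective fsrc hfsrc) (Equiv.ofBijective ftgt hftgt)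
  refine ⟨s, t, N, hX, hY, ht, m'.copy ?_ ?_ ?_ ?_⟩
  · funext p
    rcases p with _ | _ | k | k
    · simp only [Sum.elim_inl, comp_apply, Equiv.ofBijective_apply, fsrc]
      rw [hui₀, liftSet_eq hX]
    · simp only [Sum.elim_inr, Sum.elim_inl, comp_apply, Equiv.ofBijective_apply, fsrc]
      rw [hvj₀, liftSet_eq hY]
    · simp only [Sum.elim_inr, Sum.elim_inl, comp_apply, Equiv.ofBijective_apply, fsrc, t]
    · simp only [Sum.elim_inr, comp_apply, Equiv.ofBijective_apply, fsrc, t]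
      rw [hgu]
  · funext p
    rcases p with _ | _ | k | k
    · simp only [Sum.elim_inl, comp_apply, Equiv.ofBijective_apply, fsrc]
      rw [hui₀, liftFun_eq hX]
    · simp only [Sum.elim_inr, Sum.elim_inl, comp_apply, Equiv.ofBijective_apply, fsrc]
      rw [hvj₀, liftFun_eq hY]
    · simp only [Sum.elim_inr, Sum.elim_inl, comp_apply, Equiv.ofBijective_apply, fsrc, t]
    · simp only [Sum.elim_inr, comp_apply, Equiv.ofBijective_apply, fsrc, t]
      rw [hgu]
  · funext p
    rcases p with _ | _ | k | k
    · simp only [Sum.elim_inl, comp_apply, Equiv.ofBijective_apply, ftgt]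
      rw [hvj₀, liftSet_eq hY]
    · simp only [Sum.elim_inr, Sum.elim_inl, comp_apply, Equiv.ofBijective_apply, ftgt]
      rw [hui₀, liftSet_eq hX]
    · simp only [Sum.elim_inr, Sum.elim_inl, comp_apply, Equiv.ofBijective_apply, ftgt, t]
      rw [hgu]
    · simp only [Sum.elim_inr, comp_apply, Equiv.ofBijective_apply, ftgt, t]
  · funext p
    rcases p with _ | _ | k | k
    · simp only [Sum.elim_inl, comp_apply, Equiv.ofBijective_apply, ftgt]
      rw [hvj₀, liftFun_eq hY]
    · simp only [Sum.elim_inr, Sum.elim_inl, comp_apply, Equiv.ofBijective_apply, ftgt]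
      rw [hui₀, liftFun_eq hX]
    · simp only [Sum.elim_inr, Sum.elim_inl, comp_apply, Equiv.ofBijective_apply, ftgt, t]
      rw [hgu]
    · simp only [Sum.elim_inr, comp_apply, Equiv.ofBijective_apply, ftgt, t]

end Shadow

/-! ### Headline -/

/-- Registered helper goal of the stub `stub_tameForm`: comparing coefficients in the free abelian
group of a normal-form presentation. [folklore] -/
theorem tameForm_aux_countEq : ∀ {α : Type} [DecidableEq α] {a b : ℕ} (u : Fin a → α) (v : Fin b → α) (X Y : α), FreeAbelianGroup.of X - FreeAbelianGroup.of Y = ∑ i, FreeAbelianGroup.of (u i) - ∑ j, FreeAbelianGroup.of (v j) → ∀ z : α, (∑ i, if u i = z then 1 else 0 : ℕ) + (if Y = z then 1 else 0) = (∑ j, if v j = z then 1 else 0 : ℕ) + (if X = z then 1 else 0) :=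
  fun u v X Y h z => count_eq_of_eq u v X Y h z

end Summit.KontsevichZagierPeriods.KontsevichZagierPeriods.BetaCancellationDivisorSlicing

end
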